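import Literature.MathematicalPhysics.QuantumFieldTheory.Balaban1983to89.Node00.N24ItemsStage13AtThm1CCMWZBSepCoPH
import Literature.MathematicalPhysics.QuantumFieldTheory.Balaban1983to89.Node00.Record13NumericsOfThm1CCMWZBChi
import Literature.MathematicalPhysics.QuantumFieldTheory.Balaban1983to89.B16RLeafRecord13LiveCoPHChi

/-!
# NODE N24 · χ-GENERIC RE-ISSUE (WORK ORDER RC-1 «RE-CENTRE THE RECORD», director-ym №462 (B) ∕ №467 (D); op 5b) of `N24ItemsStage13AtThm1CCMWZBSepCoPH` §0:
# N13's (R₁₃) 𝐑-LEAF ∕ LAW CHAIN at the χ-slot z-witness `theta13OfThm1CCMWZBChi … χ` (node00-def-Y's H3.1 (d)) with free residual slots —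
# `N24_rOpLeaf_VOfRecord₁₃CoPH_theta13OfThm1CCMWZB_chi`, `N24_laws₁₃CoPH_theta13OfThm1CCMWZB_chi`

Cell `pub-ymgap` (HUMAN RULING D-0062, Track A).  Basename announced by seat `pub-ymgap-dag-n24-c` (g22 ■ I.22104: «g23's first act … unless n11-d posts TAKING N24 χ»);
TAKEN and typed by seat `pub-ymgap-dag-n11-d` (g44, op 5b N11 slice) because the B16RLeaf χ layer beneath it (`B16RLeafRecord13LiveCoPHChi` ✓p804077 etc.) and the ONE
consumer of record (N11's `doorRows_gaussPinH_ofHistoryBlind_theta13OfThm1CCMWZB`, the single N11 name the K1ᴬ engine reads — n24-c LOCATED-OP5B) are this lane's.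
WHAT: the two §0 theorems of the source VERBATIM modulo σ = (binder `(χ : ChiSlot F N)`; `theta13OfThm1CCMWZB … ↦ theta13OfThm1CCMWZBChi … χ` (χ LAST, def-Y's spelling);
`VOfRecord₁₃CoPH ∕ TLaw₁₃CoPH ∕ SLaw₁₃CoPH F N θ p ↦ …Chi F N θ χ p` ([Ax-3c]); `rOpLeaf_VOfRecord₁₃CoPH_iff ↦ …_iff_chi`; dag-n11-e's leaf ↦ its χ twin
`B16RLeafRecord13LiveCoPHChi.rOpLeaf_VOfRecord₁₃CoPH_liveRepin₁₃_of_hasResiduals … χ …` ✓p804077); names `…_chi` (Node00 convention).  The three admissibility ∕ residual lines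
(`theta13OfNumericsZ …` is centre-free: `.s2.lf.κ = 20000`, `.E₀ = .B₀ = 1` by `rfl`; `hasResidualsOfRecord_∕admissible_theta13OfNumericsZ`) are UNCHANGED.  §1 of the source
(the three door rows at `ofHistoryBlind ⟨θ, ZrOfRecord₁₃ θ⟩`) is not re-issued here (its consumer is the Z-door lane; Ax corollaries are `rfl` specialisations at
`χ := chiβOfRecord₁₃Ax _` for whoever wants them).  Source untouched (body-freeze №460 (2)); 0 `def` ∕ `sorry` ∕ `instance` ∕ `notation`.
HONEST FRAMING: kernel bookkeeping BY NAME in a parameter; nothing of Bałaban's asserted; NO value of `εbg` ∕ `E_k` ∕ `log z_k` pinned; K0ᴬ ∕ K1ᴬ NOT closed; N11 ∕ N13 ∕ N24 NOT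
discharged; counts unmoved; one finite 𝕋⁴ programme at fixed ε; NOT continuum ∕ ℝ⁴ ∕ OS ∕ Clay; the Yang–Mills mass gap is NOT proved.
-/

noncomputable section

open scoped Matrix.Norms.L2Operator

namespace Literature.MathematicalPhysics.QuantumFieldTheory.Balaban1983to89.Node00

open DagBinding T4Continuum T4DatumAssembly FlowStepRuns AveragingRT
open B16RLeafRecord13LiveCoPHChi (rOpLeaf_VOfRecord₁₃CoPH_liveRepin₁₃_of_hasResiduals)

variable {F : T4Family} {N : ℕ} [NeZero N]

/-! ## §0ᵡ. N13's (R₁₃) 𝐑-leaf at the χ-slot z-witness -/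

section RLeafChi

variable {j : ℕ} {γ εbg ε₀ ε₂₉ B₃ B₃' a₀ a₁ : ℝ} {Efl logz : B12.RunParams → ℕ → ℝ} (χ : ChiSlot F N) (Zr : (q : B12.RunParams) → TkResidualW F N (FluctV N) q.K)
  (Zh : (q : B12.RunParams) → ℕ → (ℕ → Set (Site (F.P q.K) 0)) → (ℕ → Set (Site (F.P q.K) 0)) → TkResidualW F N (FluctV N) q.K)
  (Phih : (q : B12.RunParams) → ℕ → (ℕ → Set (Site (F.P q.K) 0)) → (ℕ → Set (Site (F.P q.K) 0)) → (ℕ → Plaq (F.P q.K) 0 → ℝ)) (p : B12.RunParams)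

/-- **★ N13's CoPH 𝐑-leaf at the z-witness `θ₁₅ᶜᶜᴹᵂᶻ(j; γ; Efl, logz)`** with free residual slots, from the window `0 < γ ≤ ½` and the six admissibility signs — WHATEVER THE LETTERS:
dag-n11-e's θ-GENERIC re-pin leaf `rOpLeaf_VOfRecord₁₃CoPH_liveRepin₁₃_of_hasResiduals` at DEF-1's `theta13OfNumericsZ` (`θ₁₅ᶜᶜᴹᵂᶻ` IS its live re-pin, `rfl`), fed by DEF-1's
`hasResidualsOfRecord_theta13OfNumericsZ` ∕ `admissible_theta13OfNumericsZ`, dag-n21-c's `stage12NumericsOfThm1CCMW_pos_of_le_half` and the family's numerals `κ = 2·10⁴`, `E₀ = B₀ = 1` (`rfl`).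
Part 8 §0 is the `(0,0)` instance. [cite: Balaban1988Convergent, p.244, (3.16) p.268; Balaban1989LargeFieldI, (0.3)–(0.4) p.176, p.177 (i)–(ii); Balaban1989LargeFieldII, Thm 1 p.355 (not exercised); Balaban1987RG1, Thm 1 p.255, §1 p.264 (window)] -/
theorem N24_rOpLeaf_VOfRecord₁₃CoPH_theta13OfThm1CCMWZB_chi (hγ₀ : 0 < γ) (hγh : γ ≤ 1 / 2) (hbg : 0 < εbg) (hε : 0 < ε₀) (hε' : 0 < ε₂₉) (hB : 0 ≤ B₃) (hB' : 0 ≤ B₃') (ha₀ : 0 < a₀) (ha₁ : 0 < a₁) :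
    ROpLeaf (VOfRecord₁₃CoPHChi F N (⟨⟨theta13OfThm1CCMWZBChi F N j γ εbg ε₀ ε₂₉ B₃ B₃' a₀ a₁ Efl logz χ, Zr⟩, Zh, Phih⟩ : Stage13HParams F N) χ p) := by
  have hκ : (theta13OfNumericsZ F N (stage12NumericsOfThm1CCMWB F.L j γ εbg ε₀ B₃ B₃' a₀ a₁) ε₂₉ (zeta316OfRecord F N (stage12NumericsOfThm1CCMWB F.L j γ εbg ε₀ B₃ B₃' a₀ a₁).ν (stage12NumericsOfThm1CCMWB F.L j γ εbg ε₀ B₃ B₃' a₀ a₁).τ9.M (stage12NumericsOfThm1CCMWB F.L j γ εbg ε₀ B₃ B₃' a₀ a₁).A₁) (RzOfRecord F N) (ZtOfRecord F N) Efl logz).s2.lf.κ = 20000 := rfl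
  have hE : (theta13OfNumericsZ F N (stage12NumericsOfThm1CCMWB F.L j γ εbg ε₀ B₃ B₃' a₀ a₁) ε₂₉ (zeta316OfRecord F N (stage12NumericsOfThm1CCMWB F.L j γ εbg ε₀ B₃ B₃' a₀ a₁).ν (stage12NumericsOfThm1CCMWB F.L j γ εbg ε₀ B₃ B₃' a₀ a₁).τ9.M (stage12NumericsOfThm1CCMWB F.L j γ εbg ε₀ B₃ B₃' a₀ a₁).A₁) (RzOfRecord F N) (ZtOfRecord F N) Efl logz).s2.lf.E₀ = 1 := rfl
  have hB0 : (theta13OfNumericsZ F N (stage12NumericsOfThm1CCMWB F.L j γ εbg ε₀ B₃ B₃' a₀ a₁) ε₂₉ (zeta316OfRecord F N (stage12NumericsOfThm1CCMWB F.L j γ εbg ε₀ B₃ B₃' a₀ a₁).ν (stage12NumericsOfThm1CCMWB F.L j γ εbg ε₀ B₃ B₃' a₀ a₁).τ9.M (stage12NumericsOfThm1CCMWB F.L j γ εbg ε₀ B₃ B₃' a₀ a₁).A₁) (RzOfRecord F N) (ZtOfRecord F N) Efl logz).s2.lf.B₀ = 1 := rfl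
  exact rOpLeaf_VOfRecord₁₃CoPH_liveRepin₁₃_of_hasResiduals F N (theta13OfNumericsZ F N (stage12NumericsOfThm1CCMWB F.L j γ εbg ε₀ B₃ B₃' a₀ a₁) ε₂₉ (zeta316OfRecord F N (stage12NumericsOfThm1CCMWB F.L j γ εbg ε₀ B₃ B₃' a₀ a₁).ν (stage12NumericsOfThm1CCMWB F.L j γ εbg ε₀ B₃ B₃' a₀ a₁).τ9.M (stage12NumericsOfThm1CCMWB F.L j γ εbg ε₀ B₃ B₃' a₀ a₁).A₁) (RzOfRecord F N) (ZtOfRecord F N) Efl logz) χ Zr Zh Phih p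
    (hasResidualsOfRecord_theta13OfNumericsZ F N _ ε₂₉ Efl logz)
    (admissible_theta13OfNumericsZ F N _ _ _ Efl logz (stage12NumericsOfThm1CCMWB_pos_of_le_half F.hL.2.le hγ₀ hγh hbg hε hB hB' ha₀ ha₁) hε')
    (by rw [hκ]; norm_num) (by rw [hE]; norm_num) (by rw [hB0]; norm_num)

/-- **N13's (R₁₃) slot in law form at the z-witness** (free residual slots): `∀ k < K, TLaw₁₃CoPH k → SLaw₁₃CoPH (k+1)` from the window and the six signs — §0's leaf through
def-T's `rOpLeaf_VOfRecord₁₃CoPH_iff`. [cite: Balaban1988Convergent, p.244 (bookkeeping); Balaban1989LargeFieldII, Thm 1 p.355 (not exercised)] -/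
theorem N24_laws₁₃CoPH_theta13OfThm1CCMWZB_chi (hγ₀ : 0 < γ) (hγh : γ ≤ 1 / 2) (hbg : 0 < εbg) (hε : 0 < ε₀) (hε' : 0 < ε₂₉) (hB : 0 ≤ B₃) (hB' : 0 ≤ B₃') (ha₀ : 0 < a₀) (ha₁ : 0 < a₁) :
    ∀ k, k < p.K →
      TLaw₁₃CoPHChi F N (⟨⟨theta13OfThm1CCMWZBChi F N j γ εbg ε₀ ε₂₉ B₃ B₃' a₀ a₁ Efl logz χ, Zr⟩, Zh, Phih⟩ : Stage13HParams F N) χ p k →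
        SLaw₁₃CoPHChi F N (⟨⟨theta13OfThm1CCMWZBChi F N j γ εbg ε₀ ε₂₉ B₃ B₃' a₀ a₁ Efl logz χ, Zr⟩, Zh, Phih⟩ : Stage13HParams F N) χ p (k + 1) :=
  (rOpLeaf_VOfRecord₁₃CoPH_iff_chi F N _ χ p).mp (N24_rOpLeaf_VOfRecord₁₃CoPH_theta13OfThm1CCMWZB_chi χ Zr Zh Phih p hγ₀ hγh hbg hε hε' hB hB' ha₀ ha₁)

end RLeafChi

end Literature.MathematicalPhysics.QuantumFieldTheory.Balaban1983to89.Node00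

end
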